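import Literature.MathematicalPhysics.QuantumFieldTheory.Balaban1983to89.B4Ineq120RegularAmbient

/-!
# `Balaban1983to89.B4Ineq120RegularRegion` — T. Bałaban, *Regularity and decay of lattice Green's functions*, Commun.
# Math. Phys. **89** (1983) 571–597 [Balaban1983RegularityDecay] (= B4), «Proposition 2.3 of [1]» p. 574: the two-region
# bound (1.19)–(1.20) for `δC^{(k)}_Λ(Ω,Ω₀,A) = C^{(k)}_Λ(Ω,A) − C^{(k)}_Λ(Ω₀,A)` PROVED AT A REGULAR `A ≠ 0`, for EVERY `Λ`,
# on every nested pair of finite unions of `L`-blocks, by the printed §5 route (5.3)–(5.5) ⇒ Sect. 5 Theorem (5.9)–(5.10)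

statement-level skeleton of published theorems with citation tags; proofs where landed; nothing here is a claim about the Yang–Mills mass gap

PDF held: `paper:balaban1983-cmp89-regularity-decay` (journal page = PDF page + 570); pp. 573–574, 580–581, 593–594
[PDF 3–4, 10–11, 23–24] read on the ×2 renders `…/b2b-balaban-ref1/pages/1983-cmp89-regularity-decay/…-p0NN-x2.png`.

CITATION HEADER (lean-in-tree rule).  Cell `lit-balaban` (HOME `run/shared/lean/pub/lit-balaban/`), Phase-2 proof seat
**p17** gen 3 (unit `lit-balaban-p17-g3`), file 4b of the MODEL INSTANCE of SKELETON row **B4.Prop2.3[I]**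
(`B4.Prop23Printed`, owner r01, referee ref-4) AT A REGULAR `A ≠ 0`: clause (1.19)–(1.20).  This file COMPOSES landed
theorems: r01's §5 route `B4Prop23Sect5Route.prop23_120_of_cor23` (Sect. 5 Theorem (5.9)–(5.10), kernel-proved in
`B4Sect5Torus`, fed by (5.3), (5.4), (5.5)), (5.3) = `B4Ineq53RegularRegion.form115_lower_regular` on `Ω` AND on `Ω₀`
(descended to `Ω^{(k)}` by `B4Ineq120RegularAmbient.form115_lower_ambient`), (5.4) = b04's Corollary 2.3 at `A ≠ 0`
(`B4Cor23Region.cor23_pairings_set_region`, `B4Cor23Rep36Bridge.hG_regularPair`), (5.5) = b04's `δG_k(Ω,Ω₀,A)` clause of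
Corollary 2.3 at `A ≠ 0` (`B4Cor23RegionDelta.dcor23_main_region`, (1.11), `dGv`), the form matrix `H₀` of
`C^{(k)}_Λ(Ω₀,A)` (`B4Ineq120RegularAmbient.{ham0, gM0, gk_ham0, ham0_isSymm}`), the unit-lattice geometry of file 3
(`B4Prop23RegularRegion.{rhoY, suppK, rhoY_le_sdistR, …}`) and b04's `B4TwoRegion120.dSet`.

WHAT IS PRINTED (p. 574 [PDF 4], verbatim): *"Finally, for Ω ⊂ Ω₀ and δC^{(k)}_Λ(Ω,Ω₀,A) = C^{(k)}_Λ(Ω,A) −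
C^{(k)}_Λ(Ω₀,A), (1.19) we have |δC^{(k)}_Λ(Ω,Ω₀,A; x,x′)| ≤ c₀exp(−δ₀(|x−x′| + dist(x,Ω^{(k)c}) + dist(x′,Ω^{(k)c}))),
x, x′ ∈ Λ. (1.20)"*; p. 594 [PDF 24]: *"and a change of the domain Ω implies a change of the operator which can be
estimated in the following way (5.5) … From these properties it follows that Proposition I.2.3 is a consequence of the
following Theorem. … If we perturb the operator A by an operator B such that the condition (5.6) is satisfied for A + B,
and additionally B has the property |B(x,x′)| ≤ c₀e^{−δ₀(|x−x′| + dist(x,Ω^c) + dist(x′,Ω^c))}, x, x′ ∈ Ω, (5.9) then we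
have also |δC_Λ(x,x′)| ≤ c₁e^{−δ₁(|x−x′| + dist(x,Ω^c) + dist(x′,Ω^c))}, x, x′ ∈ Λ. (5.10)"*.

DICTIONARY (as files 1–4a; lattice units, `d ↦ d+1`).  `Y = Ω^{(k)} × {colours}`, `X ⊆ X₀` the fine points (× colours)
of `Ω ⊆ Ω₀`; `C^{(k)}_Λ(Ω,A)` = r01's `cLam (hamR …) a_k (QkR …) a′ L^{−2} L^{d+1} (nextAvg …) Λ`, `C^{(k)}_Λ(Ω₀,A)` = the same
with the form matrix `H₀ = ham0` of PART 1 (there: `gk H₀ a_k Q_k = [G_k(Ω₀,A)]_{ΩΩ}` and `Δ^{(k)}(Ω₀,A) + a′L^{−2}P(A)` of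
`Ω₀` restricted to `Y` IS `deltaK H₀ a_k Q_k + a′L^{−2}pOp`; the re-indexing to `Ω₀`'s own carriers is done in the sibling
`B4Prop23RegularFamily`); `|x − x′|` ↦ `|·|_∞` of the sites (`rhoY`); `dist(x, Ω^{(k)c})` ↦ `omegaY` = `|·|_∞`-distance
of the site to `Ω₀^{(k)}∖Ω^{(k)}` (`⊆ Ω^{(k)c}`; b04's reading of the complement inside the ambient region of (1.11));
`dist(supp ·, Ω^c)` of (5.5)/Cor. 2.3 ↦ `sdc` = `dist_η(sites, Ω₀∖Ω)` (b04's `bdistV` on index sets).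

WHAT IS KERNEL-CHECKED (zero `sorry`, standard axioms; no `Prop`-valued definition): §4 the three pairing inputs of r01's
route at the common constants `c₁(d,a) = c1R`, `δ₀(d,a)/2`: (5.4) for `G_k(Ω,A)` and for `[G_k(Ω₀,A)]_{ΩΩ}` (`hG_regular`,
`hG0_regular`), (5.5) (`hGd_regular`); §5 `omegaY` (+ `hω0`, `hωρ`, `hωS` of r01's route) and **`prop23_120_regular`** —
(1.19)–(1.20) AT A REGULAR `A ≠ 0` FOR EVERY `Λ ⊆ Y`: for every mesh `n ≥ 1`, `L ≥ 1`, every nested pair of finite unions of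
`L`-blocks, every `m² ∈ [0,m²₊]`, every vector field with (1.7) on `Ω₀` and `e` small (file 2's `hsmall`, `hsmallU`, `hX`):
`|C^{(k)}_Λ(Ω,A;y,y′) − C^{(k)}_Λ(Ω₀,A;y,y′)| ≤ c₀e^{−δ₀(|y−y′|_∞ + ω(y) + ω(y′))}` with EXPLICIT `c₀ = c120`, `δ₀ = d120`.
HONEST SCOPE: finite nested block unions (no infinite `Ω₀`); (1.7) demanded on `Ω₀` (as b04); the rate inherits b04's
halving in the `δG` clause (D-b04g14-3); «Λ a sum of big blocks» not needed on this route.  Unit `lit-balaban-p17-g3`.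
-/

namespace Literature.MathematicalPhysics.QuantumFieldTheory.Balaban1983to89.B4Ineq120RegularRegion

open Finset Matrix
open Literature.MathematicalPhysics.QuantumFieldTheory.Balaban1983to89
open Literature.MathematicalPhysics.QuantumFieldTheory.Balaban1983to89.B4GaugeCovariance (OrthFlow)
open Literature.MathematicalPhysics.QuantumFieldTheory.Balaban1983to89.B4Lower18Regular (e1)
open Literature.MathematicalPhysics.QuantumFieldTheory.Balaban1983to89.B4Lower18RegularRegion (rbaseEmb rbaseEmb_blk)
open Literature.MathematicalPhysics.QuantumFieldTheory.Balaban1983to89.B4Reflection242 (blk)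
open Literature.MathematicalPhysics.QuantumFieldTheory.Balaban1983to89.B4Lower18 (fineDom edistR mem_fineDom)
open Literature.MathematicalPhysics.QuantumFieldTheory.Balaban1983to89.B4ContourShift (supNorm)
open Literature.MathematicalPhysics.QuantumFieldTheory.Balaban1983to89.B4TwoRegion120 (incl fineDom_mono dSet dSet_nonneg
  dSet_le dSet_lip dSet_empty)
open Literature.MathematicalPhysics.QuantumFieldTheory.Balaban1983to89.B4Cor23Zero (edistR_nonneg)
open Literature.MathematicalPhysics.QuantumFieldTheory.Balaban1983to89.B4Cor23ZeroDelta (outR mem_outR setDist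
  setDist_le inclEmb)
open Literature.MathematicalPhysics.QuantumFieldTheory.Balaban1983to89.B4Lemma21Region (regionOp)
open Literature.MathematicalPhysics.QuantumFieldTheory.Balaban1983to89.B4Cor23Region (bsupp eq_zero_of_not_mem_bsupp
  bsuppDist bl2n c0R delta0R c0R_pos delta0R_pos delta0R_admissible cor23_pairings_set_region)
open Literature.MathematicalPhysics.QuantumFieldTheory.Balaban1983to89.B4Cor23RegionDeltaAlg (extV resV extV_of_not_mem
  extV_dotProduct extV_dotProduct_extV dGv)
open Literature.MathematicalPhysics.QuantumFieldTheory.Balaban1983to89.B4Cor23RegionDelta (bdistV c1R two_c0R_le_c1R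
  dcor23_main_region)
open Literature.MathematicalPhysics.QuantumFieldTheory.Balaban1983to89.B4RegionCov1518 (edistR_ge_supNorm_blk)
open Literature.MathematicalPhysics.QuantumFieldTheory.Balaban1983to89.B4Sect5Torus (cSt dSt)
open Literature.MathematicalPhysics.QuantumFieldTheory.Balaban1983to89.B4GaussRep36 (gk pOp cLam)
open Literature.MathematicalPhysics.QuantumFieldTheory.Balaban1983to89.B4Prop23BlockAvg (abs_pOp_le_one)
open Literature.MathematicalPhysics.QuantumFieldTheory.Balaban1983to89.B4Prop23Sect5Route (prop23_120_of_cor23)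
open Literature.MathematicalPhysics.QuantumFieldTheory.Balaban1983to89.B4Cor23Rep36Bridge (hamR QkR hamR_isSymm bl2n_sq
  sdistR gk_eq_green hG_regularPair)
open Literature.MathematicalPhysics.QuantumFieldTheory.Balaban1983to89.B4NextAvg52 (nextAvg rowOrtho_nextAvg)
open Literature.MathematicalPhysics.QuantumFieldTheory.Balaban1983to89.B4Ineq53RegularRegion (gam0 gamLow gamLow_pos
  form115_lower_regular)
open Literature.MathematicalPhysics.QuantumFieldTheory.Balaban1983to89.B4Prop23RegularRegion (rhoY profK rhoY_isPseudoDist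
  rhoY_sumBound profK_nonneg suppK QkR_row_support QkR_row_sq rhoY_le_sdistR rhoY_le_of_pOp_ne_zero)
open Literature.MathematicalPhysics.QuantumFieldTheory.Balaban1983to89.B4Ineq120RegularAmbient (inclι fine_sub gM0 ham0
  gk_ham0 ham0_isSymm resV_mulVec_extV form115_lower_ambient)

noncomputable section

variable {d : ℕ} {ι : Type} [Fintype ι] [DecidableEq ι]

/-! ## §4. The pairing inputs (5.4), (5.5) of r01's route at a regular `A ≠ 0`, common constants `c₁(d,a)`, `δ₀(d,a)/2` -/

section Pairings

variable {n L : ℕ} (hn : 1 ≤ n) (hL : 1 ≤ L) {Zc Z₀c : Finset (Fin (d + 1) → ℤ)} (hsub : Zc ⊆ Z₀c)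

/-- `dist_η(sites of U, Ω₀∖Ω)` inside `Ω₀` for an index set `U ⊆ X` (`0` if `Ω₀∖Ω` or `U` has no fine point) — r01's
`sdc U`, b04's `bdistV` on sets. [cite: Balaban1983RegularityDecay, Cor. 2.3 p.581 «dist(supp f, Ω^c)», (5.5) p.594] -/
def sdc {R R₀ : Finset (Fin (d + 1) → ℤ)} (n : ℕ) (h : R ⊆ R₀) (U : Finset (↥R × ι)) : ℝ :=
  setDist (edistR n R₀) ((U.image Prod.fst).map (inclEmb h)) (outR R R₀)

omit [DecidableEq ι] in
/-- the site support of a configuration vanishing off `U` lies in the sites of `U`. [folklore] -/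
private theorem bsupp_subset {R : Finset (Fin (d + 1) → ℤ)} {g : ↥R × ι → ℝ} {U : Finset (↥R × ι)}
    (hg : ∀ j ∉ U, g j = 0) : bsupp g ⊆ U.image Prod.fst := fun x hx => by
  by_contra hxU
  refine (Finset.mem_filter.1 hx).2 (funext fun i => hg (x, i) fun hmem => hxU ?_)
  exact Finset.mem_image.2 ⟨(x, i), hmem, rfl⟩

omit [DecidableEq ι] in
/-- a non-zero configuration has a non-empty site support. [folklore] -/
private theorem bsupp_nonempty {R : Finset (Fin (d + 1) → ℤ)} {g : ↥R × ι → ℝ} (hg : g ≠ 0) : (bsupp g).Nonempty := by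
  by_contra hne
  exact hg (funext fun j => eq_zero_of_not_mem_bsupp g j fun hj => hne ⟨_, hj⟩)

/-- monotonicity of the set distance in the first set. [folklore] -/
private theorem setDist_anti {α : Type*} (dR : α → α → ℝ) {A A' B : Finset α} (hA : A ⊆ A') (hne : A.Nonempty) :
    setDist dR A' B ≤ setDist dR A B := by
  unfold setDist
  by_cases hB : B.Nonempty
  · have h1 : (A ×ˢ B).Nonempty := Finset.Nonempty.product hne hB
    rw [dif_pos h1, dif_pos (Finset.Nonempty.product (hne.mono hA) hB)]
    exact Finset.le_inf' _ _ fun q hq => Finset.inf'_le _ (Finset.product_subset_product_left hA hq)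
  · rw [Finset.not_nonempty_iff_eq_empty] at hB
    simp [hB]

omit [Fintype ι] [DecidableEq ι] in
/-- `0 ≤ dist_η(U, U′)`. [folklore] -/
private theorem sdistR_nonneg {R : Finset (Fin (d + 1) → ℤ)} (U U' : Finset (↥(fineDom n R) × ι)) :
    0 ≤ sdistR n R U U' := by
  unfold sdistR setDist
  split_ifs with h
  · exact Finset.le_inf' _ _ fun q _ => edistR_nonneg q.1 q.2
  · exact le_rfl

/-- weakening b04's `(c₀(a), δ₀(d,a))` to the common `(c₁(d,a), δ₀(d,a)/2)`. [folklore] -/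
private theorem weaken {a t b b' s : ℝ} (ha : 0 < a) (hb : 0 ≤ b) (hb' : 0 ≤ b') (hs : 0 ≤ s)
    (h : t ≤ c0R a * b * b' * Real.exp (-(delta0R d a * s))) :
    t ≤ c1R d a * b * b' * Real.exp (-(delta0R d a / 2 * s)) := by
  have h0 := c0R_pos ha
  have h1 : c0R a ≤ c1R d a := by linarith [two_c0R_le_c1R d ha]
  have h2 : Real.exp (-(delta0R d a * s)) ≤ Real.exp (-(delta0R d a / 2 * s)) :=
    Real.exp_le_exp.2 (by nlinarith [(delta0R_pos d ha).le])
  exact h.trans (mul_le_mul (mul_le_mul_of_nonneg_right (mul_le_mul_of_nonneg_right h1 hb) hb') h2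
    (Real.exp_pos _).le (mul_nonneg (mul_nonneg (h0.le.trans h1) hb) hb'))

variable (F : OrthFlow ι) {ℓ : ℝ} (hℓ : 0 ≤ ℓ)
  (hLip : ∀ t (v : ι → ℝ), ((F.U t - 1) *ᵥ v) ⬝ᵥ ((F.U t - 1) *ᵥ v) ≤ (ℓ * t) ^ 2 * (v ⬝ᵥ v))
  {e : ℝ} (he : 0 < e) {a : ℝ} (ha : 0 < a) {m2 : ℝ} (hm : 0 ≤ m2) {Ac : (Fin (d + 1) → ℤ) → Fin (d + 1) → ℝ}
  {c β : ℝ} (hc : 0 ≤ c)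
  (h17 : ∀ x ∈ fineDom n (fineDom L Z₀c), ∀ μ ν : Fin (d + 1), |Ac (x + e1 μ) ν - Ac x ν| ≤ c * e ^ (β - 1) / n)
  (hsmall : ℓ ^ 2 * ((d + 1) * c * e ^ β) ^ 2 * (d + 1) * (1 + a * (d + 1)) ≤ min 2 a / 4)

include hsub hL hℓ hLip he ha hm hc h17 hsmall in
/-- **(5.4) FOR `G_k(Ω,A)` AT A REGULAR `A ≠ 0`** at the common constants (gen 2's `hG_regularPair`, weakened).
[cite: Balaban1983RegularityDecay, Cor. 2.3 (2.30) p.580, (5.4) p.593] -/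
theorem hG_regular (g g' : ↥(fineDom n (fineDom L Zc)) × ι → ℝ) (U U' : Finset (↥(fineDom n (fineDom L Zc)) × ι))
    (hg : ∀ x ∉ U, g x = 0) (hg' : ∀ x ∉ U', g' x = 0) :
    |g ⬝ᵥ (gk (hamR F e m2 (fineDom L Zc) Ac n) a (QkR F e hn (fineDom L Zc) Ac) *ᵥ g')|
      ≤ c1R d a * bl2n g * bl2n g' * Real.exp (-(delta0R d a / 2 * sdistR n (fineDom L Zc) U U')) :=
  weaken ha (Real.sqrt_nonneg _) (Real.sqrt_nonneg _) (sdistR_nonneg U U')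
    (hG_regularPair F hℓ hLip he hn ha hm (fineDom L Zc) hc (fun x hx => h17 x (fine_sub hn hL hsub hx)) hsmall
      g g' U U' hg hg')

include hℓ hLip he ha hm hc h17 hsmall in
/-- **(5.4) FOR `[G_k(Ω₀,A)]_{ΩΩ}` AT A REGULAR `A ≠ 0`** (r01's `hG₀`): b04's Corollary 2.3 on `Ω₀` for the extensions
by zero. [cite: Balaban1983RegularityDecay, Cor. 2.3 (2.30) p.580, (5.4) p.593] -/
theorem hG0_regular (g g' : ↥(fineDom n (fineDom L Zc)) × ι → ℝ) (U U' : Finset (↥(fineDom n (fineDom L Zc)) × ι))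
    (hg : ∀ x ∉ U, g x = 0) (hg' : ∀ x ∉ U', g' x = 0) :
    |g ⬝ᵥ (gk (ham0 F e hn hL a m2 hsub Ac) a (QkR F e hn (fineDom L Zc) Ac) *ᵥ g')|
      ≤ c1R d a * bl2n g * bl2n g' * Real.exp (-(delta0R d a / 2 * sdistR n (fineDom L Zc) U U')) := by
  obtain ⟨h0, h1, hct⟩ := delta0R_admissible d ha
  have hXX := fine_sub hn hL hsub (Zc := Zc) (Z₀c := Z₀c)
  rw [gk_ham0 hn hL hsub hℓ hLip he ha hm hc h17 hsmall,
    ← resV_mulVec_extV hXX ((regionOp F e hn a m2 (fineDom L Z₀c) Ac)⁻¹) (gM0 F e hn hL a m2 hsub Ac) (fun _ _ => rfl),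
    ← extV_dotProduct hXX]
  have hvan : ∀ (u : ↥(fineDom n (fineDom L Zc)) × ι → ℝ) (V : Finset (↥(fineDom n (fineDom L Zc)) × ι)),
      (∀ x ∉ V, u x = 0) → ∀ j : ↥(fineDom n (fineDom L Z₀c)) × ι, j.1 ∉ (V.image Prod.fst).map (inclEmb hXX) →
        extV (fineDom n (fineDom L Z₀c)) u j = 0 := by
    intro u V hu j hj
    by_cases hjR : j.1.1 ∈ fineDom n (fineDom L Zc)
    · unfold extV
      rw [dif_pos hjR]
      exact hu _ fun hmem => hj (Finset.mem_map.2 ⟨⟨j.1.1, hjR⟩, Finset.mem_image.2 ⟨_, hmem, rfl⟩, Subtype.ext rfl⟩)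
    · exact extV_of_not_mem u j hjR
  have hb : ∀ u : ↥(fineDom n (fineDom L Zc)) × ι → ℝ, bl2n (extV (fineDom n (fineDom L Z₀c)) u) = bl2n u :=
    fun u => by unfold bl2n; rw [extV_dotProduct_extV hXX]
  have h := (cor23_pairings_set_region F hℓ hLip he hn ha hm (fineDom L Z₀c) hc h17 hsmall h0 h1 hct
    ((U.image Prod.fst).map (inclEmb hXX)) ((U'.image Prod.fst).map (inclEmb hXX)) (sdistR n (fineDom L Zc) U U')
    (fun x hx t ht => ?_) _ _ (hvan g U hg) (hvan g' U' hg') 0 0).1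
  · rw [hb, hb] at h
    refine weaken ha (Real.sqrt_nonneg _) (Real.sqrt_nonneg _) (sdistR_nonneg U U') ?_
    calc _ ≤ _ := h
      _ = _ := by ring
  · obtain ⟨x₁, hx₁, rfl⟩ := Finset.mem_map.1 hx
    obtain ⟨t₁, ht₁, rfl⟩ := Finset.mem_map.1 ht
    exact setDist_le _ hx₁ ht₁

include hℓ hLip he ha hm hc h17 hsmall in
/-- **(5.5) AT A REGULAR `A ≠ 0`** (r01's `hGd`): *"a change of the domain Ω implies a change of the operator which can
be estimated in the following way (5.5)"* — `|⟨g, (G_k(Ω,A) − [G_k(Ω₀,A)]_{ΩΩ})g′⟩| ≤ c₁‖g‖‖g′‖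
e^{−(δ₀/2)(dist_η(U,U′) + dist_η(U,Ω₀∖Ω) + dist_η(U′,Ω₀∖Ω))}` for `supp g ⊆ U`, `supp g′ ⊆ U′`, from b04's `δG` clause of
Corollary 2.3 (`dcor23_main_region`, (1.11)). [cite: Balaban1983RegularityDecay, (5.5) p.594, Cor. 2.3 p.581 (δG clause), (1.11) p.573] -/
theorem hGd_regular (g g' : ↥(fineDom n (fineDom L Zc)) × ι → ℝ) (U U' : Finset (↥(fineDom n (fineDom L Zc)) × ι))
    (hg : ∀ x ∉ U, g x = 0) (hg' : ∀ x ∉ U', g' x = 0) :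
    |g ⬝ᵥ ((gk (hamR F e m2 (fineDom L Zc) Ac n) a (QkR F e hn (fineDom L Zc) Ac)
        - gk (ham0 F e hn hL a m2 hsub Ac) a (QkR F e hn (fineDom L Zc) Ac)) *ᵥ g')|
      ≤ c1R d a * bl2n g * bl2n g' * Real.exp (-(delta0R d a / 2 *
          (sdistR n (fineDom L Zc) U U' + sdc n (fine_sub hn hL hsub) U + sdc n (fine_sub hn hL hsub) U'))) := by
  have hC : 0 ≤ c1R d a := by linarith [two_c0R_le_c1R d ha, c0R_pos ha]
  have hR : ∀ u u' : ↥(fineDom n (fineDom L Zc)) × ι → ℝ, 0 ≤ c1R d a * bl2n u * bl2n u' * Real.exp (-(delta0R d a / 2 *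
      (sdistR n (fineDom L Zc) U U' + sdc n (fine_sub hn hL hsub) U + sdc n (fine_sub hn hL hsub) U'))) := fun u u' =>
    mul_nonneg (mul_nonneg (mul_nonneg hC (Real.sqrt_nonneg _)) (Real.sqrt_nonneg _)) (Real.exp_pos _).le
  by_cases hg0 : g = 0
  · rw [hg0, zero_dotProduct, abs_zero]; exact hR _ _
  by_cases hg0' : g' = 0
  · rw [hg0', Matrix.mulVec_zero, dotProduct_zero, abs_zero]; exact hR _ _
  have hXX := fine_sub hn hL hsub (Zc := Zc) (Z₀c := Z₀c)
  have hdG : (gk (hamR F e m2 (fineDom L Zc) Ac n) a (QkR F e hn (fineDom L Zc) Ac)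
      - gk (ham0 F e hn hL a m2 hsub Ac) a (QkR F e hn (fineDom L Zc) Ac)) *ᵥ g'
      = dGv hXX (regionOp F e hn a m2 (fineDom L Zc) Ac)⁻¹ (regionOp F e hn a m2 (fineDom L Z₀c) Ac)⁻¹ g' := by
    rw [Matrix.sub_mulVec, gk_eq_green, gk_ham0 hn hL hsub hℓ hLip he ha hm hc h17 hsmall,
      ← resV_mulVec_extV hXX ((regionOp F e hn a m2 (fineDom L Z₀c) Ac)⁻¹) (gM0 F e hn hL a m2 hsub Ac) (fun _ _ => rfl)]
    rfl
  rw [hdG]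
  have h := (dcor23_main_region F hℓ hLip he hn ha hm (fineDom_mono hL hsub) hc h17 hsmall g g' 0 0).1
  have hU := bsupp_subset hg
  have hU' := bsupp_subset hg'
  have hne := bsupp_nonempty hg0
  have hne' := bsupp_nonempty hg0'
  have h1 : sdistR n (fineDom L Zc) U U' ≤ bsuppDist n (fineDom n (fineDom L Zc)) g g' := by
    unfold bsuppDist
    rw [dif_pos (Finset.Nonempty.product hne hne')]
    exact Finset.le_inf' _ _ fun q hq =>
      setDist_le _ (hU (Finset.mem_product.1 hq).1) (hU' (Finset.mem_product.1 hq).2)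
  have h2 : ∀ {u : ↥(fineDom n (fineDom L Zc)) × ι → ℝ} {V : Finset (↥(fineDom n (fineDom L Zc)) × ι)},
      bsupp u ⊆ V.image Prod.fst → (bsupp u).Nonempty → sdc n hXX V ≤ bdistV n hXX u :=
    fun hV hu => setDist_anti _ (Finset.map_subset_map.2 hV) (hu.map)
  have hmono : Real.exp (-(delta0R d a / 2 * (bsuppDist n (fineDom n (fineDom L Zc)) g g' + bdistV n hXX g
      + bdistV n hXX g'))) ≤ Real.exp (-(delta0R d a / 2 *
        (sdistR n (fineDom L Zc) U U' + sdc n hXX U + sdc n hXX U'))) :=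
    Real.exp_le_exp.2 (neg_le_neg (mul_le_mul_of_nonneg_left (by linarith [h2 hU hne, h2 hU' hne'])
      (half_pos (delta0R_pos d ha)).le))
  calc _ ≤ _ := h
    _ ≤ c1R d a * Real.exp (-(delta0R d a / 2 * (sdistR n (fineDom L Zc) U U' + sdc n hXX U + sdc n hXX U')))
          * bl2n g * bl2n g' :=
        mul_le_mul_of_nonneg_right (mul_le_mul_of_nonneg_right (mul_le_mul_of_nonneg_left hmono hC)
          (Real.sqrt_nonneg _)) (Real.sqrt_nonneg _)
    _ = _ := by ring

end Pairings

/-! ## §5. The boundary weight `dist(x, Ω^{(k)c})` and (1.19)–(1.20) at a regular `A ≠ 0`, for every `Λ` -/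

section Main

/-- **`dist(x, Ω^{(k)c})`** read as the `|·|_∞`-distance of the site of `x ∈ Y` to `Ω₀^{(k)}∖Ω^{(k)}` (`0` if empty) —
b04's reading of the complement inside the ambient region of (1.11), `Ω₀^{(k)}∖Ω^{(k)} ⊆ Ω^{(k)c}`.
[cite: Balaban1983RegularityDecay, (1.20) p.574, (1.11) p.573] -/
def omegaY (L : ℕ) (Zc Z₀c : Finset (Fin (d + 1) → ℤ)) (p : ↥(fineDom L Zc) × ι) : ℝ :=
  dSet (fineDom L Z₀c \ fineDom L Zc) p.1.1

variable {n L : ℕ} (hn : 1 ≤ n) (hL : 1 ≤ L) {Zc Z₀c : Finset (Fin (d + 1) → ℤ)} (hsub : Zc ⊆ Z₀c)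

omit [Fintype ι] [DecidableEq ι] in
/-- `dist(x, Ω^{(k)c}) ≥ 0`. [cite: Balaban1983RegularityDecay, (1.20) p.574] -/
theorem omegaY_nonneg (p : ↥(fineDom L Zc) × ι) : 0 ≤ omegaY L Zc Z₀c p := dSet_nonneg _ _

omit [Fintype ι] [DecidableEq ι] in
/-- `dist(·, Ω^{(k)c})` is `1`-Lipschitz for `|·|_∞` (r01's `hωρ`). [cite: Balaban1983RegularityDecay, (1.20) p.574] -/
theorem omegaY_lip (p q : ↥(fineDom L Zc) × ι) : omegaY L Zc Z₀c p ≤ rhoY L Zc p q + omegaY L Zc Z₀c q :=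
  dSet_lip _ p.1.1 q.1.1

omit [DecidableEq ι] in
include hL in
/-- `dist(y, Ω^{(k)c}) ≤ dist_η(B^k(y), Ω₀∖Ω) + 1` (r01's `hωS`: the fine blocks have `η`-diameter `< 1`).
[cite: Balaban1983RegularityDecay, (1.20) p.574, (5.5) p.594] -/
theorem omegaY_le_sdc (p : ↥(fineDom L Zc) × ι) :
    omegaY L Zc Z₀c p ≤ sdc n (fine_sub hn hL hsub) (suppK Zc hn p) + 1 := by
  have hXX := fine_sub hn hL hsub (Zc := Zc) (Z₀c := Z₀c)
  have hsdc0 : 0 ≤ sdc n hXX (suppK (ι := ι) Zc hn p) := by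
    unfold sdc setDist
    split_ifs with h
    · exact Finset.le_inf' _ _ fun q _ => edistR_nonneg q.1 q.2
    · exact le_rfl
  rcases Finset.eq_empty_or_nonempty (fineDom L Z₀c \ fineDom L Zc) with hE | ⟨z, hz⟩
  · unfold omegaY; rw [hE, dSet_empty]; linarith
  obtain ⟨hz₀, hz₁⟩ := Finset.mem_sdiff.1 hz
  -- the product defining `sdc` is non-empty: a base point of `B^k(y)` and the base point of the block of `z`
  set S := ((suppK (ι := ι) Zc hn p).image Prod.fst).map (inclEmb hXX) with hS
  have hxS : incl hXX (rbaseEmb hn (fineDom L Zc) p.1) ∈ S :=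
    Finset.mem_map.2 ⟨_, Finset.mem_image.2 ⟨(rbaseEmb hn (fineDom L Zc) p.1, p.2),
      Finset.mem_filter.2 ⟨Finset.mem_univ _, Subtype.ext (rbaseEmb_blk hn (fineDom L Zc) p.1)⟩, rfl⟩, rfl⟩
  have htO : rbaseEmb hn (fineDom L Z₀c) ⟨z, hz₀⟩ ∈ outR (fineDom n (fineDom L Zc)) (fineDom n (fineDom L Z₀c)) := by
    rw [mem_outR, mem_fineDom hn, rbaseEmb_blk hn (fineDom L Z₀c) ⟨z, hz₀⟩]
    exact hz₁
  have hne : (S ×ˢ outR (fineDom n (fineDom L Zc)) (fineDom n (fineDom L Z₀c))).Nonempty :=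
    ⟨_, Finset.mk_mem_product hxS htO⟩
  obtain ⟨q, hq, heq⟩ := Finset.exists_mem_eq_inf' hne
    (fun pr : ↥(fineDom n (fineDom L Z₀c)) × ↥(fineDom n (fineDom L Z₀c)) => edistR n (fineDom n (fineDom L Z₀c)) pr.1 pr.2)
  have hsdc : sdc n hXX (suppK (ι := ι) Zc hn p) = edistR n (fineDom n (fineDom L Z₀c)) q.1 q.2 := by
    unfold sdc; rw [← hS]; unfold setDist; rw [dif_pos hne]; exact heq
  obtain ⟨hq1, hq2⟩ := Finset.mem_product.1 hq
  obtain ⟨x, hx, hqx⟩ := Finset.mem_map.1 hq1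
  obtain ⟨r, hr, rfl⟩ := Finset.mem_image.1 hx
  have hrb : blk n r.1.1 = p.1.1 := congrArg Subtype.val (Finset.mem_filter.1 hr).2
  have ht2 := hq2
  rw [mem_outR, mem_fineDom hn] at ht2
  have ht0 : blk n q.2.1 ∈ fineDom L Z₀c := (mem_fineDom hn).1 q.2.2
  have hmem : blk n q.2.1 ∈ fineDom L Z₀c \ fineDom L Zc := Finset.mem_sdiff.2 ⟨ht0, ht2⟩
  have h1 : omegaY L Zc Z₀c p ≤ supNorm (p.1.1 - blk n q.2.1) := dSet_le _ hmem
  have h2 := edistR_ge_supNorm_blk hn (fineDom n (fineDom L Z₀c)) q.1 q.2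
  have hq1v : blk n q.1.1 = p.1.1 := by rw [← hqx]; exact hrb
  rw [hq1v] at h2
  linarith

/-- the (5.6)/(5.9)-constant of (1.20) at a regular field: `(a_k²c₁(d,a) + a′L^{−2} + a_k)e^{3(δ₀/2)(L+1)}`.
[cite: Balaban1983RegularityDecay, (5.4)–(5.5) p.593–594, (5.9) p.594] -/
def c55 (d L : ℕ) (a a' : ℝ) : ℝ :=
  (a ^ 2 * (c1R d a * (1 * 1)) + a' * ((L : ℝ) ^ 2)⁻¹ + a) * Real.exp (3 * (delta0R d a / 2 * ((L : ℝ) + 1)))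

/-- the constant `c₀` of (1.20) at a regular field: the Sect. 5 Theorem's `cSt` at `(γ₀″, c55, δ₀/2)`.
[cite: Balaban1983RegularityDecay, (1.20) p.574, Sect. 5 Theorem (5.10) p.594] -/
def c120 (ι : Type) [Fintype ι] (d L : ℕ) (a a' m2max : ℝ) : ℝ :=
  cSt (profK ι d) (gamLow d L a a' m2max) (c55 d L a a') (delta0R d a / 2)

/-- the rate `δ₀` of (1.20) at a regular field: the Sect. 5 Theorem's `dSt` at `(γ₀″, c55, δ₀/2)`.
[cite: Balaban1983RegularityDecay, (1.20) p.574, Sect. 5 Theorem (5.10) p.594] -/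
def d120 (ι : Type) [Fintype ι] (d L : ℕ) (a a' m2max : ℝ) : ℝ :=
  dSt (profK ι d) (gamLow d L a a' m2max) (c55 d L a a') (delta0R d a / 2)

variable (F : OrthFlow ι) {ℓ : ℝ} (hℓ : 0 ≤ ℓ)
  (hLip : ∀ t (v : ι → ℝ), ((F.U t - 1) *ᵥ v) ⬝ᵥ ((F.U t - 1) *ᵥ v) ≤ (ℓ * t) ^ 2 * (v ⬝ᵥ v))
  {e : ℝ} (he : 0 < e) {a : ℝ} (ha : 0 < a) {a' : ℝ} (ha' : 0 < a') {m2 m2max : ℝ} (hm : 0 ≤ m2) (hmm : m2 ≤ m2max)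
  {Ac : (Fin (d + 1) → ℤ) → Fin (d + 1) → ℝ} {c β : ℝ} (hc : 0 ≤ c)
  (h17 : ∀ x ∈ fineDom n (fineDom L Z₀c), ∀ μ ν : Fin (d + 1), |Ac (x + e1 μ) ν - Ac x ν| ≤ c * e ^ (β - 1) / n)
  (hsmall : ℓ ^ 2 * ((d + 1) * c * e ^ β) ^ 2 * (d + 1) * (1 + a * (d + 1)) ≤ min 2 a / 4)
  (hsmallU : ℓ ^ 2 * ((d + 1) * ((L : ℝ) ^ 2 * c) * e ^ β) ^ 2 * (d + 1)
      * (1 + (a' / gam0 d a m2max) * (d + 1)) ≤ min 2 (a' / gam0 d a m2max) / 4)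
  (hX : gam0 d a m2 * (6 * (d + 1) * (a / (min 2 a / 4 + m2)) ^ 2 * (ℓ * ((3 * d + 4) * c * e ^ β)) ^ 2)
      ≤ gamLow d L a a' m2max)

include hsub hℓ hLip he ha ha' hm hmm hc h17 hsmall hsmallU hX in
/-- **B4 (1.19)–(1.20) AT A REGULAR `A ≠ 0`, EVERY `Λ`** (p. 574: *"for Ω ⊂ Ω₀ and δC^{(k)}_Λ(Ω,Ω₀,A) = C^{(k)}_Λ(Ω,A) −
C^{(k)}_Λ(Ω₀,A), (1.19) we have |δC^{(k)}_Λ(Ω,Ω₀,A; x,x′)| ≤ c₀exp(−δ₀(|x−x′| + dist(x,Ω^{(k)c}) + dist(x′,Ω^{(k)c}))), x,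
x′ ∈ Λ. (1.20)"*): for every mesh `n ≥ 1`, `L ≥ 1`, every NESTED pair `Ω^{(k)} ⊆ Ω₀^{(k)}` of finite unions of `L`-blocks
(labels `Zc ⊆ Z₀c`), every `m² ∈ [0,m²₊]`, every vector field with (1.7) `|A_ν(x+e_μ) − A_ν(x)| ≤ c·e^{β−1}/n` on `Ω₀` and
`e` small (`hsmall`, `hsmallU`, `hX` of file 2), and EVERY finite `Λ ⊆ Ω^{(k)} × {colours}`: the entries of
`C^{(k)}_Λ(Ω,A) − C^{(k)}_Λ(Ω₀,A)` (the latter with form matrix `H₀`, §2) are `≤ c₀e^{−δ₀(|y−y′|_∞ + ω(y) + ω(y′))}`,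
`ω = omegaY`, `c₀ = c120`, `δ₀ = d120` — by the PRINTED §5 ROUTE: (5.3) for both operators (`form115_lower_regular`,
`form115_lower_ambient`), (5.4) (`hG_regular`, `hG0_regular`), (5.5) (`hGd_regular`) and the Sect. 5 Theorem
(5.9) ⇒ (5.10) (r01's `prop23_120_of_cor23`). [cite: Balaban1983RegularityDecay, Prop. 2.3 of [1] (1.19)–(1.20) p.574, (5.3)–(5.5) pp.593–594, Sect. 5 Theorem (5.10) p.594] -/
theorem prop23_120_regular (Λ : Finset (↥(fineDom L Zc) × ι)) (y y' : Λ) :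
    |cLam (hamR F e m2 (fineDom L Zc) Ac n) a (QkR F e hn (fineDom L Zc) Ac) a' (((L : ℝ) ^ 2)⁻¹)
          (((L ^ (d + 1) : ℕ) : ℝ)) (nextAvg F (e / n) hL Zc n Ac) Λ y y'
      - cLam (ham0 F e hn hL a m2 hsub Ac) a (QkR F e hn (fineDom L Zc) Ac) a' (((L : ℝ) ^ 2)⁻¹)
          (((L ^ (d + 1) : ℕ) : ℝ)) (nextAvg F (e / n) hL Zc n Ac) Λ y y'|
      ≤ c120 ι d L a a' m2max *
        Real.exp (-(d120 ι d L a a' m2max * (rhoY L Zc y.1 y'.1 + omegaY L Zc Z₀c y.1 + omegaY L Zc Z₀c y'.1))) := by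
  have hL0 : (0 : ℝ) < L := by exact_mod_cast hL
  have hw : (((L ^ (d + 1) : ℕ) : ℝ)) ≠ 0 := by
    have : 0 < L ^ (d + 1) := pow_pos hL _
    exact_mod_cast this.ne'
  have hC : 0 ≤ c1R d a := by linarith [two_c0R_le_c1R d ha, c0R_pos ha]
  have h17' : ∀ x ∈ fineDom n (fineDom L Zc), ∀ μ ν : Fin (d + 1), |Ac (x + e1 μ) ν - Ac x ν| ≤ c * e ^ (β - 1) / n :=
    fun x hx => h17 x (fine_sub hn hL hsub hx)
  exact prop23_120_of_cor23 (K := profK ι d) (profK_nonneg (ι := ι)) (gamLow_pos d hL a ha' m2max)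
    (rhoY_isPseudoDist (ι := ι) Zc) (rhoY_sumBound (ι := ι) Zc) (suppK Zc hn)
    (hamR_isSymm F e m2 (fineDom L Zc) Ac) (ham0_isSymm F e hn hL a m2 hsub Ac)
    (form115_lower_regular F hℓ hLip he hn hL ha ha' hm hmm Zc hc h17' hsmall hsmallU hX)
    (form115_lower_ambient hn hL hsub hℓ hLip he ha hm hc h17 hsmall
      (form115_lower_regular F hℓ hLip he hn hL ha ha' hm hmm Z₀c hc h17 hsmall hsmallU hX))
    (QkR_row_support Zc hn F e Ac) (QkR_row_sq Zc hn F e Ac) bl2n_sq zero_le_one hC zero_le_one ha (by positivity)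
    (hG_regular hn hL hsub F hℓ hLip he ha hm hc h17 hsmall) (hG0_regular hn hL hsub F hℓ hLip he ha hm hc h17 hsmall)
    (hGd_regular hn hL hsub F hℓ hLip he ha hm hc h17 hsmall) (half_pos (delta0R_pos d ha)) (by positivity)
    (fun p q => (rhoY_le_sdistR hL Zc hn p q).trans (by linarith)) (fun p q h => (rhoY_le_of_pOp_ne_zero hL Zc F e Ac p q h).trans (by linarith))
    (fun p q => abs_pOp_le_one (rowOrtho_nextAvg F (e / n) hL Zc n Ac) hw p q) (omegaY_nonneg (Z₀c := Z₀c))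
    (omegaY_lip (Z₀c := Z₀c)) (fun p => (omegaY_le_sdc hn hL hsub p).trans (by linarith)) Λ y y'

end Main

end

end Literature.MathematicalPhysics.QuantumFieldTheory.Balaban1983to89.B4Ineq120RegularRegion
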